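import Summits.Parity.GeneralizedHardyLittlewood.Theorems.PrimeLevelFamEdgeMomentsBeyondDiagonalDiagDecorWeightOneOne
import HarnessLib

/-!
# Route `PrimeLevelFamEdge`, crux K_A `MomentsBeyondDiagonal` (stmt-Parity-20007), line «petersson_layers» v4, stub `stub_diag`:
# **the four Bose pieces of the order-`(1,1)` Selberg form in PRODUCT FORM** (the Hecke sums `Σ_{d∣k₁}Σ_{e∣k₂}` removed)

Census R3(ii), item 5 (bridge) of `Cruxes/MomentsBeyondDiagonal/Lines/petersson_layers_stub_diag_g10_blocks.md`. After
`…DiagOrderSplit.selbergForm_bose_expand` (`i = j = 1`) the order-`(1,1)` decorated Selberg form is the sum of four pieces with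
inner weights `Σ_{d∣k₁}Σ_{e∣k₂} (log(Q/n₁))^{1−a}(log(Q/n₂))^{1−b}·H_ab(n₁n₂)`, `n₁ = (k₁/d)(ge)`, `n₂ = (gd)(k₂/e)`,
`H_ab(K) = c_ab(K/Q²)`. By the weight algebra of `…DiagDecorWeightOneOne` (p824224) each piece is a PRODUCT-FORM Selberg sum
`Σ_cΣ_g μ(g)c Σ_{k₁,k₂} y′(cgk₁)y′(cgk₂)·F(g,k₁,k₂)` — the input format of `…DiagDecorShiftedLpow` / `…ShiftedP2Lpow` /
`…DecorOrderOneOnePoly` (after `c_ab = Π_ab(L) + E_ab + r_ab`, `L = log(Q²/(g²k₁k₂)) = 2(log Q − log g) − log k₁ − log k₂`):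

* `selbergPiece_one_eq` — `(a,b) = (1,1)`: `F = τ(k₁)τ(k₂)·H(g²k₁k₂)`;
* `selbergPiece_A1_eq`, `selbergPiece_A2_eq` — `(a,b) = (0,1), (1,0)`: `F = τ(k₁)τ(k₂)·(L/2)·H(g²k₁k₂)`;
* `selbergPiece_A1A2_eq` — `(a,b) = (0,0)`: `F = τ(k₁)τ(k₂)·(L²/4 − (P₂(k₁)+P₂(k₂))/4)·H(g²k₁k₂)` (squarefree reduction inside
  the form, `selbergForm_congr_squarefree`).

Exact identities, every `Q > 0`, `M`, `N`, `H : ℕ → ℝ`. Def-free; theorems only. Helper `--supports stmt-Parity-20007`; closes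
nothing; K_A, K_B and the Parity summit are NOT proved; nothing about Landau–Siegel zeros.

## References
* E. Kowalski, P. Michel, J. VanderKam, J. reine angew. Math. 526 (2000), (21)–(28) pp. 12–15.
  [cite: KowalskiMichelVanderKam2000, (23)–(28) — derivation (Hecke-divisor bookkeeping of the order-(1,1) diagonal weight)]
-/

noncomputable section

open scoped Real ArithmeticFunction.Moebius
open Finset ArithmeticFunction Polynomial

namespace Summit.Parity.GeneralizedHardyLittlewood.Theorems.MomentsBeyondDiagonal.DiagKernel

open Literature.NumberTheory.LFunctions Literature.NumberTheory.LFunctions.KMV2000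

/-- Piece `(a,b) = (1,1)` in product form: inner weight `Σ_{d,e}H(n₁n₂) = τ(k₁)τ(k₂)H(g²k₁k₂)`.
[cite: KowalskiMichelVanderKam2000, (23)–(28) — derivation] -/
theorem selbergPiece_one_eq (P : ℝ[X]) (M : ℝ) (N : ℕ) (H : ℕ → ℝ) :
    ∑ c ∈ Icc 1 N, ∑ g ∈ Icc 1 (N / c), (μ g : ℝ) * c *
        ∑ k₁ ∈ Icc 1 (N / (c * g)), ∑ k₂ ∈ Icc 1 (N / (c * g)),
          ((μ (c * g * k₁) : ℝ) * ((psi (c * g * k₁))⁻¹ *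
              P.eval (Real.log (M / ((c * g * k₁ : ℕ) : ℝ)) / Real.log M)) / ((c * g * k₁ : ℕ) : ℝ)) *
            ((μ (c * g * k₂) : ℝ) * ((psi (c * g * k₂))⁻¹ *
              P.eval (Real.log (M / ((c * g * k₂ : ℕ) : ℝ)) / Real.log M)) / ((c * g * k₂ : ℕ) : ℝ)) *
            ∑ d ∈ k₁.divisors, ∑ e ∈ k₂.divisors, H (k₁ / d * (g * e) * (g * d * (k₂ / e))) =
      ∑ c ∈ Icc 1 N, ∑ g ∈ Icc 1 (N / c), (μ g : ℝ) * c *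
        ∑ k₁ ∈ Icc 1 (N / (c * g)), ∑ k₂ ∈ Icc 1 (N / (c * g)),
          ((μ (c * g * k₁) : ℝ) * ((psi (c * g * k₁))⁻¹ *
              P.eval (Real.log (M / ((c * g * k₁ : ℕ) : ℝ)) / Real.log M)) / ((c * g * k₁ : ℕ) : ℝ)) *
            ((μ (c * g * k₂) : ℝ) * ((psi (c * g * k₂))⁻¹ *
              P.eval (Real.log (M / ((c * g * k₂ : ℕ) : ℝ)) / Real.log M)) / ((c * g * k₂ : ℕ) : ℝ)) *
            ((k₁.divisors.card : ℝ) * (k₂.divisors.card : ℝ) * H (g * g * (k₁ * k₂))) := by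
  refine Finset.sum_congr rfl fun c _ ↦ Finset.sum_congr rfl fun g _ ↦ ?_
  congr 1
  refine Finset.sum_congr rfl fun k₁ _ ↦ Finset.sum_congr rfl fun k₂ _ ↦ ?_
  rw [inner_weight_one H g k₁ k₂]

/-- Piece `(a,b) = (0,1)` in product form: inner weight `Σ_{d,e}log(Q/n₁)H(n₁n₂) = τ(k₁)τ(k₂)(L/2)H(g²k₁k₂)`,
`L = 2(log Q − log g) − log k₁ − log k₂` (`Q > 0`). [cite: KowalskiMichelVanderKam2000, (23)–(28) — derivation] -/
theorem selbergPiece_A1_eq (P : ℝ[X]) (M : ℝ) (N : ℕ) (H : ℕ → ℝ) {Q : ℝ} (hQ : 0 < Q) :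
    ∑ c ∈ Icc 1 N, ∑ g ∈ Icc 1 (N / c), (μ g : ℝ) * c *
        ∑ k₁ ∈ Icc 1 (N / (c * g)), ∑ k₂ ∈ Icc 1 (N / (c * g)),
          ((μ (c * g * k₁) : ℝ) * ((psi (c * g * k₁))⁻¹ *
              P.eval (Real.log (M / ((c * g * k₁ : ℕ) : ℝ)) / Real.log M)) / ((c * g * k₁ : ℕ) : ℝ)) *
            ((μ (c * g * k₂) : ℝ) * ((psi (c * g * k₂))⁻¹ *
              P.eval (Real.log (M / ((c * g * k₂ : ℕ) : ℝ)) / Real.log M)) / ((c * g * k₂ : ℕ) : ℝ)) *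
            ∑ d ∈ k₁.divisors, ∑ e ∈ k₂.divisors,
              Real.log (Q / ((k₁ / d * (g * e) : ℕ) : ℝ)) * H (k₁ / d * (g * e) * (g * d * (k₂ / e))) =
      ∑ c ∈ Icc 1 N, ∑ g ∈ Icc 1 (N / c), (μ g : ℝ) * c *
        ∑ k₁ ∈ Icc 1 (N / (c * g)), ∑ k₂ ∈ Icc 1 (N / (c * g)),
          ((μ (c * g * k₁) : ℝ) * ((psi (c * g * k₁))⁻¹ *
              P.eval (Real.log (M / ((c * g * k₁ : ℕ) : ℝ)) / Real.log M)) / ((c * g * k₁ : ℕ) : ℝ)) *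
            ((μ (c * g * k₂) : ℝ) * ((psi (c * g * k₂))⁻¹ *
              P.eval (Real.log (M / ((c * g * k₂ : ℕ) : ℝ)) / Real.log M)) / ((c * g * k₂ : ℕ) : ℝ)) *
            ((k₁.divisors.card : ℝ) * (k₂.divisors.card : ℝ) *
              ((2 * (Real.log Q - Real.log g) - Real.log k₁ - Real.log k₂) / 2) * H (g * g * (k₁ * k₂))) := by
  refine Finset.sum_congr rfl fun c _ ↦ Finset.sum_congr rfl fun g hg ↦ ?_
  have hg0 : g ≠ 0 := by have := (Finset.mem_Icc.1 hg).1; omega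
  congr 1
  refine Finset.sum_congr rfl fun k₁ hk₁ ↦ Finset.sum_congr rfl fun k₂ hk₂ ↦ ?_
  have hk₁0 : k₁ ≠ 0 := by have := (Finset.mem_Icc.1 hk₁).1; omega
  have hk₂0 : k₂ ≠ 0 := by have := (Finset.mem_Icc.1 hk₂).1; omega
  rw [inner_weight_A1 H hQ hg0 hk₁0 hk₂0]

/-- Piece `(a,b) = (1,0)` in product form: inner weight `Σ_{d,e}log(Q/n₂)H(n₁n₂) = τ(k₁)τ(k₂)(L/2)H(g²k₁k₂)` (`Q > 0`).
[cite: KowalskiMichelVanderKam2000, (23)–(28) — derivation] -/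
theorem selbergPiece_A2_eq (P : ℝ[X]) (M : ℝ) (N : ℕ) (H : ℕ → ℝ) {Q : ℝ} (hQ : 0 < Q) :
    ∑ c ∈ Icc 1 N, ∑ g ∈ Icc 1 (N / c), (μ g : ℝ) * c *
        ∑ k₁ ∈ Icc 1 (N / (c * g)), ∑ k₂ ∈ Icc 1 (N / (c * g)),
          ((μ (c * g * k₁) : ℝ) * ((psi (c * g * k₁))⁻¹ *
              P.eval (Real.log (M / ((c * g * k₁ : ℕ) : ℝ)) / Real.log M)) / ((c * g * k₁ : ℕ) : ℝ)) *
            ((μ (c * g * k₂) : ℝ) * ((psi (c * g * k₂))⁻¹ *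
              P.eval (Real.log (M / ((c * g * k₂ : ℕ) : ℝ)) / Real.log M)) / ((c * g * k₂ : ℕ) : ℝ)) *
            ∑ d ∈ k₁.divisors, ∑ e ∈ k₂.divisors,
              Real.log (Q / ((g * d * (k₂ / e) : ℕ) : ℝ)) * H (k₁ / d * (g * e) * (g * d * (k₂ / e))) =
      ∑ c ∈ Icc 1 N, ∑ g ∈ Icc 1 (N / c), (μ g : ℝ) * c *
        ∑ k₁ ∈ Icc 1 (N / (c * g)), ∑ k₂ ∈ Icc 1 (N / (c * g)),
          ((μ (c * g * k₁) : ℝ) * ((psi (c * g * k₁))⁻¹ *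
              P.eval (Real.log (M / ((c * g * k₁ : ℕ) : ℝ)) / Real.log M)) / ((c * g * k₁ : ℕ) : ℝ)) *
            ((μ (c * g * k₂) : ℝ) * ((psi (c * g * k₂))⁻¹ *
              P.eval (Real.log (M / ((c * g * k₂ : ℕ) : ℝ)) / Real.log M)) / ((c * g * k₂ : ℕ) : ℝ)) *
            ((k₁.divisors.card : ℝ) * (k₂.divisors.card : ℝ) *
              ((2 * (Real.log Q - Real.log g) - Real.log k₁ - Real.log k₂) / 2) * H (g * g * (k₁ * k₂))) := by
  refine Finset.sum_congr rfl fun c _ ↦ Finset.sum_congr rfl fun g hg ↦ ?_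
  have hg0 : g ≠ 0 := by have := (Finset.mem_Icc.1 hg).1; omega
  congr 1
  refine Finset.sum_congr rfl fun k₁ hk₁ ↦ Finset.sum_congr rfl fun k₂ hk₂ ↦ ?_
  have hk₁0 : k₁ ≠ 0 := by have := (Finset.mem_Icc.1 hk₁).1; omega
  have hk₂0 : k₂ ≠ 0 := by have := (Finset.mem_Icc.1 hk₂).1; omega
  rw [inner_weight_A2 H hQ hg0 hk₁0 hk₂0]

/-- Piece `(a,b) = (0,0)` in product form: inner weight `Σ_{d,e}log(Q/n₁)log(Q/n₂)H(n₁n₂)` may be replaced by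
`τ(k₁)τ(k₂)(L²/4 − (P₂(k₁)+P₂(k₂))/4)H(g²k₁k₂)` inside the form (only squarefree `k₁, k₂` count; `Q > 0`).
[cite: KowalskiMichelVanderKam2000, (23)–(28) — derivation] -/
theorem selbergPiece_A1A2_eq (P : ℝ[X]) (M : ℝ) (N : ℕ) (H : ℕ → ℝ) {Q : ℝ} (hQ : 0 < Q) :
    ∑ c ∈ Icc 1 N, ∑ g ∈ Icc 1 (N / c), (μ g : ℝ) * c *
        ∑ k₁ ∈ Icc 1 (N / (c * g)), ∑ k₂ ∈ Icc 1 (N / (c * g)),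
          ((μ (c * g * k₁) : ℝ) * ((psi (c * g * k₁))⁻¹ *
              P.eval (Real.log (M / ((c * g * k₁ : ℕ) : ℝ)) / Real.log M)) / ((c * g * k₁ : ℕ) : ℝ)) *
            ((μ (c * g * k₂) : ℝ) * ((psi (c * g * k₂))⁻¹ *
              P.eval (Real.log (M / ((c * g * k₂ : ℕ) : ℝ)) / Real.log M)) / ((c * g * k₂ : ℕ) : ℝ)) *
            ∑ d ∈ k₁.divisors, ∑ e ∈ k₂.divisors,
              Real.log (Q / ((k₁ / d * (g * e) : ℕ) : ℝ)) * Real.log (Q / ((g * d * (k₂ / e) : ℕ) : ℝ)) *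
                H (k₁ / d * (g * e) * (g * d * (k₂ / e))) =
      ∑ c ∈ Icc 1 N, ∑ g ∈ Icc 1 (N / c), (μ g : ℝ) * c *
        ∑ k₁ ∈ Icc 1 (N / (c * g)), ∑ k₂ ∈ Icc 1 (N / (c * g)),
          ((μ (c * g * k₁) : ℝ) * ((psi (c * g * k₁))⁻¹ *
              P.eval (Real.log (M / ((c * g * k₁ : ℕ) : ℝ)) / Real.log M)) / ((c * g * k₁ : ℕ) : ℝ)) *
            ((μ (c * g * k₂) : ℝ) * ((psi (c * g * k₂))⁻¹ *
              P.eval (Real.log (M / ((c * g * k₂ : ℕ) : ℝ)) / Real.log M)) / ((c * g * k₂ : ℕ) : ℝ)) *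
            ((k₁.divisors.card : ℝ) * (k₂.divisors.card : ℝ) *
              ((2 * (Real.log Q - Real.log g) - Real.log k₁ - Real.log k₂) ^ 2 / 4 -
                ((∑ p ∈ k₁.primeFactors, Real.log p ^ 2) + ∑ p ∈ k₂.primeFactors, Real.log p ^ 2) / 4) *
              H (g * g * (k₁ * k₂))) := by
  -- only squarefree `k₁, k₂` count; reduce on `g ≥ 1` inside the form
  have hred := selbergForm_congr_squarefree P M N
    (fun c g k₁ k₂ ↦ ∑ d ∈ k₁.divisors, ∑ e ∈ k₂.divisors,
      Real.log (Q / ((k₁ / d * (g * e) : ℕ) : ℝ)) * Real.log (Q / ((g * d * (k₂ / e) : ℕ) : ℝ)) *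
        H (k₁ / d * (g * e) * (g * d * (k₂ / e))))
    (fun c g k₁ k₂ ↦ if g = 0 then ∑ d ∈ k₁.divisors, ∑ e ∈ k₂.divisors,
      Real.log (Q / ((k₁ / d * (g * e) : ℕ) : ℝ)) * Real.log (Q / ((g * d * (k₂ / e) : ℕ) : ℝ)) *
        H (k₁ / d * (g * e) * (g * d * (k₂ / e))) else
      (k₁.divisors.card : ℝ) * (k₂.divisors.card : ℝ) *
        ((2 * (Real.log Q - Real.log g) - Real.log k₁ - Real.log k₂) ^ 2 / 4 -
          ((∑ p ∈ k₁.primeFactors, Real.log p ^ 2) + ∑ p ∈ k₂.primeFactors, Real.log p ^ 2) / 4) *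
        H (g * g * (k₁ * k₂)))
    (fun c g k₁ k₂ h₁ h₂ ↦ by
      by_cases hg : g = 0
      · simp only [hg, if_true]
      · simp only [hg, if_false]
        exact inner_weight_A1A2_of_squarefree H hQ hg h₁ h₂)
  rw [hred]
  refine Finset.sum_congr rfl fun c _ ↦ Finset.sum_congr rfl fun g hg ↦ ?_
  have hg0 : g ≠ 0 := by have := (Finset.mem_Icc.1 hg).1; omega
  simp only [hg0, if_false]

end Summit.Parity.GeneralizedHardyLittlewood.Theorems.MomentsBeyondDiagonal.DiagKernel

end
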